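import Literature.AlgebraicGeometry.Resolution.ArithmeticalThreefoldsLocal
import Literature.AlgebraicGeometry.Resolution.LocalModels
import Literature.AlgebraicGeometry.Resolution.ResidueAlgebraicTower
import Literature.AlgebraicGeometry.Resolution.ModelTransport
import Literature.AlgebraicGeometry.Resolution.ExcellentRingsCompleteHolds
import Literature.AlgebraicGeometry.Resolution.CoefficientRingsProofs
import Literature.AlgebraicGeometry.Resolution.SmoothUniformization
import Literature.AlgebraicGeometry.Resolution.AffineDomainDimension
import Literature.AlgebraicGeometry.Resolution.RegularLocalRingsProofs
import Mathlib.FieldTheory.IsAlgClosed.AlgebraicClosure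
import HarnessLib

/-!
# Cossart–Piltant, Prop. 4.10: reduction of (LU) for complete local domains to climbing over the Cohen subring

Topic: `Literature/AlgebraicGeometry/Resolution`. PROOF side of the named fact
`CossartPiltant2019ReductionP` (`ArithmeticalThreefoldsLocal.lean`): Cossart–Piltant 2019,
proof of journal Prop. 4.10 = arXiv v1 Prop. 4.8 (pp. 53–54), "Theorem 1.5 implies Theorem 1.1"
in residue characteristic `p > 0`. The printed proof begins

> "it is sufficient to prove that (LU) holds for every complete local domain `(A, m, k)` of
> dimension three. Let `(𝒪_v, m_v, k_v)` be the given valuation ring as in (LU). … By [Ma]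
> theorem 29.4 (iii), there exists a complete regular local ring `S ⊆ A` such that `A` is a
> finite `S`-module and `dim S = 3`. Let `F := QF(S)`, so `K | F` is a finite field extension"

and then climbs from `(LU v₀)` (`v₀ = v|F`, which holds as `S` is regular) to `(LU v)` along the
ramification-theoretic tower `F ⊆ Fⁱ ⊆ Fʳ ⊆ Kʳ ⊇ Kⁱ ⊇ K` inside a Galois closure, by Galois
approximation (Prop. 4.13), [CoP1] Cor. 7.3, Props. 6.3, 9.1, 9.3, principalization (Prop. 4.4)
and Thm. 1.5 (i)/(ii) for the degree-`p` steps. This file PROVES everything in that proof which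
is NOT the climb, reducing `CossartPiltant2019ReductionP` to a self-contained climbing statement
over the Cohen subring (`cossartPiltant2019ReductionP_of_climb`):

* `exists_cohen_subring` — Cohen's structure theorem (Matsumura Thm. 29.4 (iii),
  `Matsumura1987_29_4_iii_holds`) packaged with excellence (Stacks 07QW,
  `isExcellentRing_of_isAdicComplete`), dimension (`ringKrullDim_eq_of_isIntegral`) and residue
  characteristic of `S`;
* `isRegularLocalRing_localization_iff_of_subalgebra_eq` — bookkeeping;
* `cossartPiltant2019ReductionP_of_climb` — the reduction: one fraction field `K₀` of `A`
  (`cpLocalUniformization_of_fractionField'`, keeping the residue hypothesis of (LU)); Cohen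
  subring `S ⊆ A`; `E = K̄₀` and an extension `O_E` of `𝒪_v` (Chevalley,
  `exists_valuationSubring_comap_eq`); domination and residue algebraicity moved from
  `(A, K₀, 𝒪_v)` to `(S, E, O_E)` (`ResidueAlgebraicTower.lean`); the climbing hypothesis applied
  to `K = K₀ ⊆ E`, generated over `F` by `S`-module generators of `A`; the model pulled back to
  `K₀` (`ModelTransport.lean`) with `Frac S[t] = K₀`; and the passage from the base `S` to the
  base `A` with the same generators — `S[t] ⊆ A[t] ⊆ S[t]_P` since the regular local ring
  `S[t]_P` is normal (`LocalModels.lean`).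

The climbing statement `CLIMB` (the hypothesis of `cossartPiltant2019ReductionP_of_climb`, after
`CossartPiltant2019Local →`): for every complete excellent regular local domain `S` of dimension
three and residue characteristic `p`, every algebraically closed field `E ⊇ S` algebraic over `S`,
every valuation ring `O_E ∋ S` of `E` dominating `S` with residue field algebraic over `S/𝔪_S`
(elementary rendering), and every finite `s₀ ⊆ E`: some finite `t ⊆ E` with `t ⊆ F(s₀)`,
`s₀ ⊆ F(t)` (`F = Frac S`; so `Frac S[t] = F(s₀)`) has `S[t] ⊆ O_E` regular at the centre of
`O_E`. Its degree-`p` steps are the local theorem over the local rings of the previous models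
(`ArithmeticalThreefoldsLocalStep.lean`); the rest is [CoP1] §§6–9 and Prop. 4.4, 4.13.

Everything here is PROVED; no named facts are introduced.

## Sources

* V. Cossart, O. Piltant, J. Algebra 529 (2019) 268–535 = arXiv:1412.0868, proof of Prop. 4.10
  (arXiv v1: Prop. 4.8, pp. 53–54). [CossartPiltant2019]
* H. Matsumura, *Commutative Ring Theory*, CUP 1986, Thm. 29.4 (iii), Thm. 9.4. [Matsumura1987]
-/

noncomputable section

open IsLocalRing Polynomial

namespace Literature.AlgebraicGeometry.Resolution

universe u

/-! ## Cohen's structure theorem, packaged -/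

/-- **Cohen subring of a complete local domain of dimension three** (Matsumura Thm. 29.4 (iii),
`Matsumura1987_29_4_iii_holds`, packaged with what the reduction needs): a complete Noetherian
local domain `A` of dimension `3` with residue characteristic `p` is module-finite over a complete
regular local subring `S`, which is excellent (Stacks 07QW, `isExcellentRing_of_isAdicComplete`),
of dimension `3` (integral extensions preserve dimension, Matsumura Thm. 9.4) and of residue
characteristic `p` (`S/𝔪_S ⊆ A/𝔪_A`). (Cossart–Piltant 2019, proof of Prop. 4.10: "there exists
a complete regular local ring `S ⊆ A` such that `A` is a finite `S`-module and `dim S = 3`",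
citing Matsumura Thm. 29.4.) [cite: CossartPiltant2019, proof of Prop. 4.10 (arXiv v1: Prop. 4.8, p. 54)]
[cite: Matsumura1987, Thm. 29.4 (iii)] -/
theorem exists_cohen_subring (p : ℕ) (A : Type u) [CommRing A] [IsDomain A] [IsLocalRing A]
    [IsNoetherianRing A] [IsAdicComplete (maximalIdeal A) A] (hdim : ringKrullDim A = 3)
    (hchar : CharP (ResidueField A) p) :
    ∃ (S : Subring A) (_ : IsRegularLocalRing S), IsAdicComplete (maximalIdeal S) S ∧
      Module.Finite S A ∧ IsExcellentRing S ∧ ringKrullDim S = 3 ∧ CharP (ResidueField S) p := by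
  obtain ⟨S, hreg, hcomp, hfin⟩ := Matsumura1987_29_4_iii_holds A
  haveI := hreg
  haveI := hcomp
  haveI := hfin
  haveI : Algebra.IsIntegral S A := Algebra.IsIntegral.of_finite S A
  haveI : IsLocalHom (algebraMap S A) := isLocalHom_algebraMap_of_isIntegral
  refine ⟨S, hreg, hcomp, hfin, isExcellentRing_of_isAdicComplete S, ?_, ?_⟩
  · rw [← hdim]
    exact (ringKrullDim_eq_of_isIntegral (R := S) (S := A) Subtype.val_injective).symm
  · exact (RingHom.charP_iff_charP (ResidueField.map (algebraMap S A)) p).mpr hchar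

/-! ## Transport between equal models -/

/-- Two descriptions `R₁ = R₂` of the same subalgebra, with centres both cut out by `v < 1`, have
isomorphic local rings at the centre. [folklore] -/
theorem isRegularLocalRing_localization_iff_of_subalgebra_eq {S L : Type u} [CommRing S] [Field L]
    [Algebra S L] (O : ValuationSubring L) {R₁ R₂ : Subalgebra S L} (h : R₁ = R₂)
    (P₁ : Ideal R₁) [P₁.IsPrime] (hP₁ : ∀ x : R₁, x ∈ P₁ ↔ O.valuation (x : L) < 1)
    (P₂ : Ideal R₂) [P₂.IsPrime] (hP₂ : ∀ x : R₂, x ∈ P₂ ↔ O.valuation (x : L) < 1) :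
    IsRegularLocalRing (Localization.AtPrime P₁) ↔ IsRegularLocalRing (Localization.AtPrime P₂) := by
  subst h
  have hP : P₁ = P₂ := by ext x; rw [hP₁, hP₂]
  subst hP
  exact Iff.rfl

/-! ## The reduction to climbing over the Cohen subring -/

/-- **Cossart–Piltant 2019, proof of Prop. 4.10 (arXiv v1 Prop. 4.8), the reduction steps
preceding the ramification-theoretic climb** — PROVED: to establish (LU) for every complete
Noetherian local domain `A` of dimension three and residue characteristic `p` from the local
theorem, it suffices to prove, for every complete excellent regular local domain `S` of dimension
three and residue characteristic `p` (the Cohen subring of `A`), every valuation ring `O_E` of an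
algebraically closed field `E ⊇ S` (algebraic over `S`) dominating `S` with residue field
algebraic over `S/𝔪_S`, and every finitely generated subfield `K = Frac(S)(s₀) ⊆ E`, that SOME
finitely generated model `S[t] ⊆ O_E` with `t ⊆ K` and `Frac S[t] = K` is regular at the centre
of `O_E` ("(LU v) for the models of `v|S` on `K`", which the source obtains by climbing the tower
`F ⊆ Fⁱ ⊆ Fʳ ⊆ Kʳ ⊇ Kⁱ ⊇ K`). The reduction: (LU) may be checked in one fraction field `K₀` of
`A` (`cpLocalUniformization_of_fractionField'`); Cohen's structure theorem gives `S ⊆ A`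
(`exists_cohen_subring`); extend `v` to `E = K̄₀` (Chevalley, `exists_valuationSubring_comap_eq`);
domination and residue algebraicity pass from `(A, K₀, O)` to `(S, E, O_E)`
(`ResidueAlgebraicTower.lean`); apply the climbing hypothesis to `K = K₀ ⊆ E`, generated over
`Frac S` by module generators of `A`; pull the model back to `K₀` (`ModelTransport.lean`); and pass
from the base `S` to the base `A` with the same generators, `S[t] ⊆ A[t] ⊆ S[t]_P` by normality
of the regular local ring `S[t]_P` (`LocalModels.lean`).
[cite: CossartPiltant2019, proof of Prop. 4.10 (arXiv v1: Prop. 4.8, pp. 53–54)] -/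
theorem cossartPiltant2019ReductionP_of_climb
    (H : CossartPiltant2019Local.{u} →
      ∀ (p : ℕ), p.Prime →
      ∀ (S : Type u) [CommRing S] [IsDomain S] [IsRegularLocalRing S],
        IsExcellentRing S → ringKrullDim S = 3 → CharP (ResidueField S) p →
        IsAdicComplete (maximalIdeal S) S →
      ∀ (E : Type u) [Field E] [Algebra S E], Function.Injective (algebraMap S E) →
        IsAlgClosed E → Algebra.IsAlgebraic S E →
      ∀ (OE : ValuationSubring E), (∀ s : S, algebraMap S E s ∈ OE) →
        (∀ s ∈ maximalIdeal S, OE.valuation (algebraMap S E s) < 1) →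
        (∀ y : OE, ∃ q : S[X], (∃ i, q.coeff i ∉ maximalIdeal S) ∧
          OE.valuation (q.eval₂ (algebraMap S E) y) < 1) →
      ∀ (s₀ : Finset E),
        ∃ t : Finset E,
          (t : Set E) ⊆ Subfield.closure (Set.range (algebraMap S E) ∪ (s₀ : Set E)) ∧
          (s₀ : Set E) ⊆ Subfield.closure (Set.range (algebraMap S E) ∪ (t : Set E)) ∧
          ∃ hTO : (Algebra.adjoin S (t : Set E)).toSubring ≤ OE.toSubring,
            IsRegularLocalRing (Localization.AtPrime
              (Ideal.comap (Subring.inclusion hTO) (maximalIdeal OE)))) :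
    CossartPiltant2019ReductionP.{u} := by
  intro hloc p hp A _ _ _ _ _ hdim hchar
  classical
  refine cpLocalUniformization_of_fractionField' A (FractionRing A) fun O hAO hdom halg => ?_
  -- Cohen subring `S ⊆ A`
  obtain ⟨S, hreg, hcomp, hfin, hexc, hdimS, hcharS⟩ := exists_cohen_subring p A hdim hchar
  haveI := hreg
  haveI := hcomp
  haveI := hfin
  haveI : Algebra.IsIntegral S A := Algebra.IsIntegral.of_finite S A
  haveI : IsLocalHom (algebraMap S A) := isLocalHom_algebraMap_of_isIntegral
  -- the fields `K₀ = Frac A ⊆ E = K̄₀` and an extension `O_E` of `O`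
  set K₀ := FractionRing A with hK₀
  let E := AlgebraicClosure K₀
  obtain ⟨OE, hOE⟩ := exists_valuationSubring_comap_eq (Ω := E) O
  let φ : K₀ →ₐ[S] E := IsScalarTower.toAlgHom S K₀ E
  have hφ : ∀ z, φ z = algebraMap K₀ E z := fun _ => rfl
  have hSE : ∀ s : S, algebraMap S E s = algebraMap K₀ E (algebraMap A K₀ (s : A)) := fun s => by
    rw [IsScalarTower.algebraMap_apply S K₀ E, IsScalarTower.algebraMap_apply S A K₀]
    rfl
  -- hypotheses of the climb at the level of `S`
  have hinjSE : Function.Injective (algebraMap S E) := by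
    intro a b hab
    rw [hSE, hSE] at hab
    exact Subtype.val_injective (IsFractionRing.injective A K₀ ((algebraMap K₀ E).injective hab))
  have halgSE : Algebra.IsAlgebraic S E := by
    haveI : Algebra.IsAlgebraic A K₀ := IsLocalization.isAlgebraic K₀ (nonZeroDivisors A)
    haveI : Algebra.IsAlgebraic S A := Algebra.IsIntegral.isAlgebraic
    refine ⟨fun e => ?_⟩
    have h1 : IsAlgebraic K₀ e := Algebra.IsAlgebraic.isAlgebraic e
    have h2 : IsAlgebraic A e := IsAlgebraic.restrictScalars A h1
    exact IsAlgebraic.restrictScalars S h2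
  have hSO : ∀ s : S, algebraMap S E s ∈ OE := fun s => by
    rw [hSE, ← ValuationSubring.mem_comap, hOE]
    exact hAO _
  have hdomS : ∀ s ∈ maximalIdeal S, OE.valuation (algebraMap S E s) < 1 := fun s hs => by
    rw [hSE, valuation_algebraMap_lt_one_iff_of_comap_eq' O OE hOE]
    exact valuation_algebraMap_lt_one_of_isLocalHom O hdom s hs
  have halgS : ∀ y : OE, ∃ q : S[X], (∃ i, q.coeff i ∉ maximalIdeal S) ∧
      OE.valuation (q.eval₂ (algebraMap S E) y) < 1 :=
    forall_exists_valuation_eval₂_lt_one_of_tower O OE hOE hAO hdom halg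
  -- `K₀ = Frac(S)(s₀)` for module generators `s₀` of `A` over `S`
  obtain ⟨g, hg⟩ := Module.Finite.fg_top (R := S) (M := A)
  let s₀ : Finset E := g.image fun a => algebraMap K₀ E (algebraMap A K₀ a)
  -- CLIMB
  obtain ⟨t, ht₁, ht₂, hTO, hreg⟩ := H hloc p hp S hexc hdimS hcharS hcomp E hinjSE
    inferInstance halgSE OE hSO hdomS halgS s₀
  -- `t ⊆ K₀`: pull back along `φ`
  have hrange : ∀ e ∈ t, e ∈ Set.range (algebraMap K₀ E) := by
    have hcl : Subfield.closure (Set.range (algebraMap S E) ∪ (s₀ : Set E)) ≤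
        (algebraMap K₀ E).fieldRange := by
      rw [Subfield.closure_le]
      rintro e (⟨s, rfl⟩ | he)
      · exact ⟨algebraMap A K₀ (s : A), (hSE s).symm⟩
      · obtain ⟨a, -, rfl⟩ := Finset.mem_image.mp (Finset.mem_coe.mp he)
        exact ⟨_, rfl⟩
    intro e he
    exact hcl (ht₁ (Finset.mem_coe.mpr he))
  have hinjφ : Function.Injective (algebraMap K₀ E) := (algebraMap K₀ E).injective
  let t₀ : Finset K₀ := t.preimage (algebraMap K₀ E) (hinjφ.injOn)
  have ht₀ : t₀.image (algebraMap K₀ E) = t := by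
    rw [Finset.image_preimage]
    exact Finset.filter_true_of_mem hrange
  have ht₀' : (algebraMap K₀ E) '' (t₀ : Set K₀) = (t : Set E) := by
    rw [← Finset.coe_image, ht₀]
  -- the model over `S` inside `K₀` and its image in `E`
  set T₀ : Subalgebra S K₀ := Algebra.adjoin S (t₀ : Set K₀) with hT₀def
  have hmapT : T₀.map φ = Algebra.adjoin S (t : Set E) := by
    rw [hT₀def, AlgHom.map_adjoin]
    congr 1
  have hT₀O : T₀.toSubring ≤ O.toSubring := by
    intro z hz
    have h1 : φ z ∈ T₀.map φ := Subalgebra.mem_map.mpr ⟨z, hz, rfl⟩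
    rw [hmapT] at h1
    have h2 : algebraMap K₀ E z ∈ OE := hTO h1
    rw [← ValuationSubring.mem_comap, hOE] at h2
    exact h2
  -- regularity of `S[t₀]` at the centre of `O`
  set P₀ : Ideal T₀ := Ideal.comap (Subring.inclusion hT₀O) (maximalIdeal O) with hP₀def
  haveI : P₀.IsPrime := Ideal.IsPrime.comap _
  have hP₀ : ∀ x : T₀, x ∈ P₀ ↔ O.valuation (x : K₀) < 1 := fun x => by
    rw [hP₀def, Ideal.mem_comap, ValuationSubring.valuation_lt_one_iff]; rfl
  have hP₀E : ∀ x : T₀, x ∈ P₀ ↔ OE.valuation (φ x) < 1 := fun x => by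
    rw [hP₀, hφ, valuation_algebraMap_lt_one_iff_of_comap_eq' O OE hOE]
  have hmapO : (T₀.map φ).toSubring ≤ OE.toSubring := by rw [hmapT]; exact hTO
  set Q : Ideal (T₀.map φ) := Ideal.comap (Subring.inclusion hmapO) (maximalIdeal OE) with hQdef
  haveI : Q.IsPrime := Ideal.IsPrime.comap _
  have hQ : ∀ y : T₀.map φ, y ∈ Q ↔ OE.valuation (y : E) < 1 := fun y => by
    rw [hQdef, Ideal.mem_comap, ValuationSubring.valuation_lt_one_iff]; rfl
  set Pt : Ideal (Algebra.adjoin S (t : Set E)) :=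
    Ideal.comap (Subring.inclusion hTO) (maximalIdeal OE) with hPtdef
  haveI : Pt.IsPrime := Ideal.IsPrime.comap _
  have hPt : ∀ y : Algebra.adjoin S (t : Set E), y ∈ Pt ↔ OE.valuation (y : E) < 1 := fun y => by
    rw [hPtdef, Ideal.mem_comap, ValuationSubring.valuation_lt_one_iff]; rfl
  have hregQ : IsRegularLocalRing (Localization.AtPrime Q) :=
    (isRegularLocalRing_localization_iff_of_subalgebra_eq OE hmapT Q hQ Pt hPt).mpr hreg
  have hreg₀ : IsRegularLocalRing (Localization.AtPrime P₀) :=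
    (isRegularLocalRing_localization_map_iff φ OE T₀ P₀ hP₀E Q hQ).mpr hregQ
  -- `Frac S[t₀] = K₀`
  have hfrac : IsFractionRing T₀ K₀ := by
    let C : Subfield K₀ := Subfield.closure (Set.range (algebraMap S K₀) ∪ (t₀ : Set K₀))
    -- `s₀ ⊆ C.map φ`
    have hCmap : Subfield.closure (Set.range (algebraMap S E) ∪ (t : Set E)) ≤
        C.map (algebraMap K₀ E) := by
      rw [Subfield.closure_le]
      rintro e (⟨s, rfl⟩ | he)
      · refine Subfield.mem_map.mpr ⟨algebraMap S K₀ s, Subfield.subset_closure (Or.inl ⟨s, rfl⟩), ?_⟩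
        rw [hSE, IsScalarTower.algebraMap_apply S A K₀]
        rfl
      · rw [← ht₀'] at he
        obtain ⟨z, hz, rfl⟩ := he
        exact Subfield.mem_map.mpr ⟨z, Subfield.subset_closure (Or.inr hz), rfl⟩
    have hgC : ∀ a ∈ g, algebraMap A K₀ a ∈ C := by
      intro a ha
      have h1 : algebraMap K₀ E (algebraMap A K₀ a) ∈ C.map (algebraMap K₀ E) := by
        apply hCmap
        apply ht₂
        exact Finset.mem_coe.mpr (Finset.mem_image.mpr ⟨a, ha, rfl⟩)
      obtain ⟨c, hc, hce⟩ := Subfield.mem_map.mp h1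
      rw [← hinjφ hce]
      exact hc
    have hAC : ∀ a : A, algebraMap A K₀ a ∈ C := by
      intro a
      have ha : a ∈ Submodule.span S (g : Set A) := by rw [hg]; exact Submodule.mem_top
      refine Submodule.span_induction (p := fun a _ => algebraMap A K₀ a ∈ C) ?_ ?_ ?_ ?_ ha
      · exact fun a ha => hgC a (Finset.mem_coe.mp ha)
      · rw [map_zero]; exact zero_mem _
      · intro x y _ _ hx hy
        rw [map_add]; exact add_mem hx hy
      · intro c x _ hx
        rw [Algebra.smul_def, map_mul, ← IsScalarTower.algebraMap_apply]
        exact mul_mem (Subfield.subset_closure (Or.inl ⟨c, rfl⟩)) hx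
    have hC : ∀ z : K₀, z ∈ C := by
      intro z
      obtain ⟨a, b, -, rfl⟩ := IsFractionRing.div_surjective (A := A) z
      exact div_mem (hAC a) (hAC b)
    have hcl : Subring.closure (Set.range (algebraMap S K₀) ∪ (t₀ : Set K₀)) ≤ T₀.toSubring := by
      rw [Subring.closure_le]
      rintro z (⟨s, rfl⟩ | hz)
      · exact T₀.algebraMap_mem s
      · exact Algebra.subset_adjoin hz
    haveI : FaithfulSMul T₀ K₀ :=
      (faithfulSMul_iff_algebraMap_injective _ _).mpr Subtype.val_injective
    refine IsFractionRing.of_field T₀ K₀ fun z => ?_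
    obtain ⟨y, hy, w, hw, hyw⟩ := Subfield.mem_closure_iff.mp (hC z)
    exact ⟨⟨y, hcl hy⟩, ⟨w, hcl hw⟩, hyw.symm⟩
  -- pass from the base `S` to the base `A`
  obtain ⟨h, hregA⟩ := exists_adjoin_isRegularLocalRing_of_isIntegral (S := S) (A := A) O t₀
    hT₀O hfrac hreg₀
  exact ⟨t₀, h, hregA⟩

end Literature.AlgebraicGeometry.Resolution
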